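/-
Copyright: cell `pub-ymgap` (HUMAN RULING D-0062), Track A of `YM-PLAN.md`, DAG node N20 (= NE7b); R134 acceleration seat
`pub-ymgap-dag-n20-c` (strategy s1, generation 8), module 42.  Released under the licence of the surrounding project.
-/
import Summits.QuantumFields.YangMills.Theorems.BalabanUVNodesN20LCSWallShape
import Summits.QuantumFields.YangMills.Theorems.BalabanUVNodesN20LCSHullDisplay
import Literature.MathematicalPhysics.QuantumFieldTheory.Balaban1983to89.B15Claim189LambdaPin
import HarnessLib

/-!
# YM-DAG node N20 (= NE7b), row s1, module 42: THE GEOMETRIC SEPARATION — the box-hull of the regularity regions of the NEXT step's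
# window cubes misses the regularity regions of the PREVIOUS step's large family; the repaired display (modules 39–41) is immune to
# module 38's forcing

Track A of `YM-PLAN.md` (cell `pub-ymgap`, HUMAN RULING D-0062), node **N20** = spine estimate NE7b (`T4WeightBudget.RelWeightBound`, NOT
PRINTED, NOT PROVED).  Seat `pub-ymgap-dag-n20-c` (R134, s1 «the first missing estimate»), generation 8, module 42 (imports modules 38
`…N20LCSWallShape` and 40 `…N20LCSHullDisplay`, and dag-n12-e's `B15Claim189LambdaPin` for its §1 torus-lattice toolkit `coordDist`).  Kernel theorems
only: 0 `def`, 0 `sorry`, standard axioms; COUNT-NEUTRAL.  Lattice geometry over node00-def-T's layer algebra BY NAME; it asserts nothing of Bałaban's.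

WHY.  Module 38 certified that the display «LCS-j for EVERY level-j plaquette set X» is over-strong: on the support of the level-`(k+1)` term of a
history whose last label declares the χ_{k+1}-cube `c` large, the regularity letter forces a LARGE level-`(k+1)` plaquette inside the regularity region
`R k c`, so «LCS-(k+1)» at `X := R k c` forces a useless constant.  Modules 39–41 re-displayed the chain with «LCS-(k+1)» asked ONLY for `X` inside the
box-hull `{q | ∃ c″ ∈ D, ∃ p′ ∈ R (k+1) c″, q ∈ boxRegion (emb p′.src) ((d+3)L+2)}` of the regularity regions of cubes `c″ ∈ D ⊆ cubes32 (k+1) (seqOfHist (k+1) h)`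
— the (3.2) WINDOW `(Z̃_{k+1}^{∼4})ᶜ` of the next step.  THIS FILE proves the consistency of the repair: such `X` NEVER meet `R k c` — so module 38 §1's
forced plaquette lies outside every admissible `X` (§5) — under three displayed letters: a LOCALITY letter on the regularity regions (`R j c` sits
within `r j` layers of χ_{j+1}-cubes of `c` on the fine torus), `0 < M`, and print's numeric nesting «M much larger than M₂» ([Balaban1988Convergent]
p. 245: *«M₁ < M₂ < M … we fix M₂ not too much larger than M₁, e.g., we can take M₂ = L²M₁, and M will be chosen much larger than M₂. The choice will
be dictated by many conditions»*) in the form `(r k + 1)·sideχ k + L^{k+1}·ρ + (r (k+1) + 1)·sideχ (k+1) ≤ 4·sideD (k+1) + 2` (fine sites; `sideχ j =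
L^{j+2}M₂R_{j+1}`, `sideD j = L^{j+1}MR_{j+1}`, i.e. `(r_k+1)M₂R_{k+1} + (r_{k+1}+1)LM₂R_{k+2} + ρ∕L ≲ 4MR_{k+2}`).

THE ARGUMENT (print's layer calculus, [Balaban1988Convergent] p. 264–265).  `c ∈ t.1 = P_{k+1}` lies in `Z_{k+1} = Λ_{k+1}(t)ᶜ` (def-T's guard
`Ω_{k+1}(t) ⊆ (∪P_{k+1})ᶜ` and `Λ_{k+1}(t) ⊆ Ω_{k+1}(t)`), while a window cube `c″ ∈ cubes32 (k+1) (σ s t)` lies in `(Z̃_{k+1}^{∼4})ᶜ`, `Z̃^{∼4} = hullD 4 (hullD 0 Z)`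
over the 𝐃_{k+2}-cubes (side `sideD (k+1)`): so SOME coordinate of any point of `c″` is `> 4·sideD (k+1)` cyclic steps from any point of `c` (dag-n12-e's
`exists_lt_coordDist_of_not_mem_hullD`).  A common plaquette `q ∈ R k c ∩ boxRegion (emb p′.src) ρ`, `p′ ∈ R (k+1) c″`, would put its fine position
`embIter (k+1) q.src` within `(r k + 1)·sideχ k − 1` of `c` AND within `L^{k+1}·ρ + (r (k+1) + 1)·sideχ (k+1) − 1` of `c″` in EVERY coordinate
(`embIter` is affine with slope `L^j` on labels; collars of one cube) — contradicting the nesting by the coordinatewise triangle inequality.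

* §1 TORUS LATTICE over `coordDist` (generic `P : Params`): symmetry, triangle inequality, the integer-offset bound (`x i = y i + e ⇒ coordDist ≤ |e|`),
  the cover bound, ★ `coordDist_lt_of_mem_cubeEnl` (points of the `n`- and `m`-collars of ONE `s`-cube are `< (n+m+1)s` apart in every coordinate),
  `val_embIter_eq_pow_mul_add` (`(embIter j y)_ν = L^j·y_ν + off_j` on labels, standing range `j ≤ m + K`), ★ `coordDist_embIter_le_of_eq_add`,
  ★ `coordDist_embIter_le_of_mem_boxRegion` (n20-d's `boxRegion x ρ` read on the fine torus: `≤ L^j·ρ` coordinatewise).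
* §2 DEF-T's WINDOW BY NAME: `exists_lt_coordDist_of_mem_W32` (`y ∈ W32`, `z ∈ Zreg`, `0 < sideD` ⇒ `∃ i, 4·sideD < coordDist z y i`),
  `cubeχ_subset_Zreg_σOfRecord` (`c ∈ t.1 ⇒ cubeχ k c ⊆ Zreg (k+1) (σ s t)`), `cubeχ_subset_W32_of_mem_cubes32`, `sideD_pos_of_pos`.
* §3 ★★ `exists_lt_coordDist_of_collars` — THE FINE-TORUS GAP between the collars of `c ∈ t.1` and of `c″ ∈ cubes32 (k+1) (σ s t)` under the nesting.
* §4 ★★ `not_mem_of_mem_boxRegion` — THE PLAQUETTE SEPARATION: `p′ ∈ R (k+1) c″`, `q ∈ boxRegion (emb p′.src) ρ` ⇒ `q ∉ R k c` (locality letters at `k`, `k+1`).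
* §5 AT THE DISPLAY: ★★★ `disjoint_hull_labelAt` — for EVERY history `h : Fin (k+1) → LabelPat`, every `c` in its last label's large family, every
  `D ⊆ cubes32 (k+1) (seqOfHist (k+1) h)` and every `X` admissible in module 40 §3's sense, `Disjoint X (R k c)`; `disjoint_hull_of_mem_admS` (module 38 §3's
  pinned-class shape); ★★★ `forced_plaquette_not_mem_hull` — module 38 §1's forced large plaquette lies OUTSIDE every admissible `X` of modules 40 ∕ 41.

HONEST FRAMING.  Combinatorial geometry of the torus of record; the regularity letter `hreg`, «LCS-j on the hull of window-admissible pins» ((A1c), THE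
wall), the reading and the 𝐑-step stay exactly as displayed in modules 40 ∕ 41.  NE7b NOT PRINTED ∕ NOT PROVED; (α)-instance 0∕1; N20 NOT discharged;
typed 28∕28, discharged count untouched; one finite four-torus at fixed `ε` — NOT ℝ⁴, NOT infinite volume, NOT OS, NOT a mass gap, NOT Clay.

References (LOCATORS): T. Bałaban, CMP 119 (1988) 243–285 [Balaban1988Convergent] (p. 245 (`M₁ < M₂ < M`), (2.17) p. 257, (3.2)–(3.5) p. 264–265,
(3.20) p. 269); CMP 109 (1987) 249–301 [Balaban1987RG1] ((0.1) p. 251 (the tori `T^{(j)}`, centres), p. 257 (`M` ≫ the fixed scales)); CMP 122 (1989)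
175–202 [Balaban1989LargeFieldI] ((0.3)–(0.5) pp. 176–177); CMP 102 (1985) 277–309 [Balaban1985Variational] (Thm 1 p. 279, the SHAPE of `hreg`).
-/

set_option autoImplicit false

noncomputable section

open scoped BigOperators

namespace Summit.QuantumFields.YangMills.BalabanUVNodes.N20LCSHullSeparation

open MeasureTheory
open Literature.MathematicalPhysics.QuantumFieldTheory.Balaban1983to89
open Literature.MathematicalPhysics.QuantumFieldTheory.Balaban1983to89.T4Continuum
open Literature.MathematicalPhysics.QuantumFieldTheory.Balaban1983to89.B14.Eq218Concrete
open Literature.MathematicalPhysics.QuantumFieldTheory.Balaban1983to89.Node00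
open Literature.MathematicalPhysics.QuantumFieldTheory.Balaban1983to89.B15DeterminingSets (embIter)
open Literature.MathematicalPhysics.QuantumFieldTheory.Balaban1983to89.B15Eq112TorusCover (cover)
open Literature.MathematicalPhysics.QuantumFieldTheory.Balaban1983to89.B14.Eq213MaximalDomains (cubeExt)
open Literature.MathematicalPhysics.QuantumFieldTheory.Balaban1983to89.B14DomainGeom (Pt)
open Literature.MathematicalPhysics.QuantumFieldTheory.Balaban1983to89.B15Claim189LambdaPin
  (coordDist coordDist_eq_natAbs coordDist_self exists_lt_coordDist_of_not_mem_hullD mem_hullD_of_near)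
open Literature.MathematicalPhysics.QuantumFieldTheory.Balaban1983to89.B14SeparationOfRecord (one_le_RkOfRecord)
open Summit.QuantumFields.YangMills.BalabanUVNodes.N20LCSAvgDominationRegion (boxRegion mem_boxRegion)

/-! ## §1 Torus lattice: the coordinate cyclic distances of the fine torus -/

section Lattice

variable {P : Params}

/-- `coordDist` is symmetric. [folklore] -/
theorem coordDist_comm (x y : Site P 0) (i : Fin P.d) : coordDist x y i = coordDist y x i := by
  unfold coordDist
  exact min_comm _ _

/-- **TRIANGLE INEQUALITY** for the coordinate cyclic distance (balanced residues are subadditive in absolute value). [folklore] -/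
theorem coordDist_triangle (x y z : Site P 0) (i : Fin P.d) : coordDist x z i ≤ coordDist x y i + coordDist y z i := by
  rw [coordDist_eq_natAbs, coordDist_eq_natAbs, coordDist_eq_natAbs,
    show x i - z i = (x i - y i) + (y i - z i) by ring]
  exact (ZMod.natAbs_valMinAbs_add_le _ _).trans (Int.natAbs_add_le _ _)

/-- **INTEGER OFFSETS BOUND THE CYCLIC DISTANCE**: if `x i = y i + e` for an integer `e`, then `coordDist x y i ≤ |e|` (the balanced residue is the
representative of least absolute value). [folklore] -/
theorem coordDist_le_natAbs_of_eq_add {x y : Site P 0} {i : Fin P.d} {e : ℤ}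
    (h : x i = y i + (e : ZMod (P.sitesPerDir 0))) : coordDist x y i ≤ e.natAbs := by
  rw [coordDist_eq_natAbs, show x i - y i = (e : ZMod (P.sitesPerDir 0)) by rw [h]; ring]
  exact ZMod.natAbs_min_of_le_div_two (P.sitesPerDir 0) _ e (ZMod.coe_valMinAbs _) (ZMod.natAbs_valMinAbs_le _)

/-- **THE COVER BOUND**: two points of the universal cover project to torus sites whose `i`-th cyclic distance is at most `|z₁ i − z₂ i|`. [folklore] -/
theorem coordDist_cover_le_natAbs (z₁ z₂ : Pt P.d) (i : Fin P.d) :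
    coordDist (cover P z₁) (cover P z₂) i ≤ (z₁ i - z₂ i).natAbs := by
  refine coordDist_le_natAbs_of_eq_add ?_
  simp only [cover, Int.cast_sub]
  ring

/-- ★ **COLLARS OF ONE CUBE ARE UNIFORMLY CLOSE**: a point of the `n`-collar and a point of the `m`-collar of the SAME `s`-cube of the torus partition are
`< (n + m + 1)·s` apart in EVERY coordinate (cover representatives in the box `[s·a_i − n·s, s·a_i + s − 1 + m·s]`).
[cite: Balaban1988Convergent, (2.16)–(2.17) p.257, p.264–265 (the layer calculus «surrounded by n layers»)] -/
theorem coordDist_lt_of_mem_cubeEnl {s : ℕ} {a : Pt P.d} {n m : ℕ} {x y : Site P 0} (hx : x ∈ cubeEnl P s a n) (hy : y ∈ cubeEnl P s a m)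
    (i : Fin P.d) : coordDist x y i < (n + m + 1) * s := by
  obtain ⟨z₁, hz₁, rfl⟩ := hx
  obtain ⟨z₂, hz₂, rfl⟩ := hy
  have h1 := hz₁ i
  have h2 := hz₂ i
  have h := coordDist_cover_le_natAbs (P := P) z₁ z₂ i
  have h3 : (n + m + 1) * s = n * s + m * s + s := by ring
  rw [h3]
  generalize (s : ℤ) * a i = A at h1 h2
  omega

/-- **`embIter j` IS AFFINE WITH SLOPE `L^j` ON LABELS**: there is an offset `off` (namely `(L^j − 1)∕2`, the iterated centre offset of `Setup.emb`) with
`((embIter j y) ν).val = L^j·(y ν).val + off` for every site `y` of `T^{(j)}` and every direction — no reduction modulo the site count occurs in the standing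
range `j ≤ m + K` (`Site.val_emb`). [cite: Balaban1987RG1, (0.1) p.251–252 (the lattices of centres)] -/
theorem val_embIter_eq_pow_mul_add {j : ℕ} (hj : j ≤ P.m + P.K) :
    ∃ off : ℕ, ∀ (y : Site P j) (ν : Fin P.d), ((embIter j y) ν).val = P.L ^ j * (y ν).val + off := by
  induction j with
  | zero => exact ⟨0, fun y ν => by simp [embIter]⟩
  | succ j ih =>
    obtain ⟨off, hoff⟩ := ih (by omega)
    refine ⟨P.L ^ j * ((P.L - 1) / 2) + off, fun y ν => ?_⟩
    show ((embIter j (emb y)) ν).val = _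
    rw [hoff (emb y) ν, Site.val_emb (by omega) y ν, pow_succ]
    ring

/-- ★ **INTEGER OFFSETS AT SCALE `j` BECOME `L^j`-FOLD OFFSETS ON THE FINE TORUS**: if `x ν = y ν + e` in `T^{(j)}` (`e ∈ ℤ`, `j ≤ m + K`), then
`(embIter j x) ν = (embIter j y) ν + L^j·e` in `T^{(0)}`, hence `coordDist (embIter j x) (embIter j y) ν ≤ L^j·|e|`. [cite: Balaban1987RG1, (0.1) p.251–252] -/
theorem coordDist_embIter_le_of_eq_add {j : ℕ} (hj : j ≤ P.m + P.K) {x y : Site P j} {ν : Fin P.d} {e : ℤ}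
    (h : x ν = y ν + (e : ZMod (P.sitesPerDir j))) :
    coordDist (embIter j x) (embIter j y) ν ≤ P.L ^ j * e.natAbs := by
  obtain ⟨off, hoff⟩ := val_embIter_eq_pow_mul_add (P := P) hj
  -- the congruence of labels at scale `j`
  have h1 : (((x ν).val : ℤ) : ZMod (P.sitesPerDir j)) = ((((y ν).val : ℤ) + e : ℤ) : ZMod (P.sitesPerDir j)) := by
    push_cast
    rw [ZMod.natCast_zmod_val, ZMod.natCast_zmod_val, h]
  rw [ZMod.intCast_eq_intCast_iff_dvd_sub] at h1
  -- multiplied by `L^j` it is a congruence of fine labels (the finest torus has `L^j` times as many sites per direction as `T^{(j)}`;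
  -- cf. `Prop7FlatCoercivity.sitesPerDir_zero_eq_pow_mul`, not imported here)
  have hN : P.sitesPerDir 0 = P.L ^ j * P.sitesPerDir j := by
    unfold Params.sitesPerDir
    rw [Nat.sub_zero, mul_left_comm, ← pow_add, Nat.add_sub_cancel' hj]
  have h2 : ((P.sitesPerDir 0 : ℕ) : ℤ) ∣
      ((((embIter j y) ν).val : ℤ) + (P.L ^ j : ℕ) * e) - (((embIter j x) ν).val : ℤ) := by
    rw [hoff x ν, hoff y ν, hN]
    push_cast
    have : ((P.L : ℤ) ^ j * (y ν).val + off + (P.L : ℤ) ^ j * e) - ((P.L : ℤ) ^ j * (x ν).val + off) =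
        (P.L : ℤ) ^ j * (((y ν).val + e) - (x ν).val) := by ring
    rw [this]
    exact mul_dvd_mul_left _ h1
  rw [← ZMod.intCast_eq_intCast_iff_dvd_sub] at h2
  have h3 : (embIter j x) ν = (embIter j y) ν + (((P.L ^ j : ℕ) * e : ℤ) : ZMod (P.sitesPerDir 0)) := by
    rw [← ZMod.natCast_zmod_val ((embIter j x) ν), ← ZMod.natCast_zmod_val ((embIter j y) ν)]
    exact_mod_cast h2
  refine (coordDist_le_natAbs_of_eq_add h3).trans ?_
  rw [Int.natAbs_mul, Int.natAbs_natCast]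

/-- ★ **n20-d's BOX REGION READ ON THE FINE TORUS**: a plaquette of `boxRegion x ρ` (scale `j ≤ m + K`: its corner is `x + e` with `|e_ν| ≤ ρ`) has its corner's
fine position within `L^j·ρ` of the fine position of `x` in EVERY coordinate. [cite: Balaban1987RG1, (0.1) p.251–252, (0.3) p.252] -/
theorem coordDist_embIter_le_of_mem_boxRegion {j : ℕ} (hj : j ≤ P.m + P.K) {x : Site P j} {ρ : ℕ} {q : Plaq P j} (hq : q ∈ boxRegion x ρ)
    (ν : Fin P.d) : coordDist (embIter j q.src) (embIter j x) ν ≤ P.L ^ j * ρ := by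
  obtain ⟨e, he, hqe⟩ := (mem_boxRegion.1 hq) ν
  refine (coordDist_embIter_le_of_eq_add hj hqe).trans (Nat.mul_le_mul_left _ ?_)
  have : (e.natAbs : ℤ) ≤ (ρ : ℤ) := by rw [Int.natCast_natAbs]; exact he
  exact_mod_cast this

end Lattice

/-! ## §2 def-T's (3.2) window by name: the gap `> 4·sideD` between `Z_k = Λ_kᶜ` and `(Z̃_k^{∼4})ᶜ` -/

section Window

variable (F : T4Family) (ν : Stage7Numerics) (M : ℕ) (p : B12.RunParams) (g : ℕ → ℝ)

/-- The side of the 𝐃-cubes of record is positive once `0 < M` (`0 < L`, `1 ≤ R_j`). [cite: Balaban1988Convergent, (2.1) p.254 (bookkeeping)] -/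
theorem sideD_pos_of_pos (hM : 0 < M) (k : ℕ) : 0 < sideD F ν M p g k := by
  unfold sideD dCubeSide
  exact Nat.mul_pos (Nat.mul_pos (pow_pos (F.P p.K).L_pos _) hM) (one_le_RkOfRecord (F.P p.K).L_pos _ _)

/-- **THE WINDOW GAP**: a point `y` of the (3.2) window `W32 k s = (Z̃_k^{∼4})ᶜ` and a point `z` of the large-field region `Z_k` are `> 4·sideD k` cyclic steps apart in
SOME coordinate (`Z̃_k^{∼4} = hullD 4 (hullD 0 Z_k)` over the 𝐃_{k+1}-cubes; dag-n12-e's `exists_lt_coordDist_of_not_mem_hullD`).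
[cite: Balaban1988Convergent, p.264–265 («we surround … by four layers of the LMR_{k+1}-cubes»)] -/
theorem exists_lt_coordDist_of_mem_W32 {k : ℕ} (hD : 0 < sideD F ν M p g k) (s : SeqOfRecord F ν M g p.K k) {y z : Site (F.P p.K) 0}
    (hy : y ∈ W32 F ν M p g k s) (hz : z ∈ Zreg F ν M p g k s) : ∃ i, 4 * sideD F ν M p g k < coordDist z y i := by
  have hz' : z ∈ hullD (F.P p.K) (sideD F ν M p g k) 0 (Zreg F ν M p g k s) :=
    mem_hullD_of_near hD hz fun i => by rw [coordDist_self]; exact Nat.zero_le _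
  exact exists_lt_coordDist_of_not_mem_hullD hD hz' hy

/-- **THE PREVIOUS LARGE FAMILY LIES IN THE NEW LARGE-FIELD REGION**: for `c ∈ t.1 = P_{k+1}`, `cubeχ k c ⊆ Z_{k+1} = Λ_{k+1}(t)ᶜ` along `σ s t` (def-T's guard
`Ω_{k+1}(t) ⊆ (∪P_{k+1})ᶜ` and `Λ_{k+1}(t) ⊆ Ω_{k+1}(t)`). [cite: Balaban1988Convergent, (3.5) p.265, (3.20) p.269, (2.3) p.255] -/
theorem cubeχ_subset_Zreg_σOfRecord {k : ℕ} (s : SeqOfRecord F ν M g p.K k) (t : LbOfRecord F ν p g k) {c : Iχ F ν p g k} (hc : c ∈ t.1) :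
    cubeχ F ν p g k c ⊆ Zreg F ν M p g (k + 1) (σOfRecord F ν M p g k s t) := by
  intro x hx
  rw [Zreg, if_pos (Nat.succ_le_succ (Nat.zero_le k)), σOfRecord_Λ_succ]
  intro hxΛ
  have hxG := OmegaOfLabel_subset_guard F ν M p g k s t (LambdaOfLabel_subset F ν M p g k s t hxΛ)
  exact hxG.2 (Set.mem_iUnion₂.2 ⟨c, hc, hx⟩)

/-- A cube of the (3.2) range `cubes32 k s` lies in the window `W32 k s` (def-T's `cubesIn`). [cite: Balaban1988Convergent, (3.2) p.265] -/
theorem cubeχ_subset_W32_of_mem_cubes32 {k : ℕ} (s : SeqOfRecord F ν M g p.K k) {c : Iχ F ν p g k} (hc : c ∈ cubes32 F ν M p g k s) :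
    cubeχ F ν p g k c ⊆ W32 F ν M p g k s := by
  rw [cubes32, mem_cubesIn] at hc
  exact hc

end Window

/-! ## §3 The fine-torus gap between the collars of the previous large family and of the next window's cubes -/

section Gap

variable (F : T4Family) (ν : Stage7Numerics) (M : ℕ) (p : B12.RunParams) (g : ℕ → ℝ)

/-- ★★ **THE GAP**: along `σ s t`, a fine point `u` within `r₁` layers of χ_{k+1}-cubes of a cube `c ∈ t.1` of the previous large family and a fine point `w`
within `r₂` layers of χ_{k+2}-cubes of a window cube `c″ ∈ cubes32 (k+1) (σ s t)` are `> ρ` cyclic steps apart in SOME coordinate, whenever `0 < sideD (k+1)` and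
`(r₁ + 1)·sideχ k + ρ + (r₂ + 1)·sideχ (k+1) ≤ 4·sideD (k+1) + 2` (print's «M much larger than M₂»). [cite: Balaban1988Convergent, p.245, p.264–265, (3.2) p.265] -/
theorem exists_lt_coordDist_of_collars {k : ℕ} (hD : 0 < sideD F ν M p g (k + 1)) (s : SeqOfRecord F ν M g p.K k) (t : LbOfRecord F ν p g k)
    {c : Iχ F ν p g k} (hc : c ∈ t.1) {c'' : Iχ F ν p g (k + 1)} (hc'' : c'' ∈ cubes32 F ν M p g (k + 1) (σOfRecord F ν M p g k s t))
    {r₁ r₂ ρ : ℕ} {u w : Site (F.P p.K) 0} (hu : u ∈ cubeEnl (F.P p.K) (sideχ F ν p g k) c r₁)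
    (hw : w ∈ cubeEnl (F.P p.K) (sideχ F ν p g (k + 1)) c'' r₂)
    (hnum : (r₁ + 1) * sideχ F ν p g k + ρ + (r₂ + 1) * sideχ F ν p g (k + 1) ≤ 4 * sideD F ν M p g (k + 1) + 2) :
    ∃ i, ρ < coordDist u w i := by
  obtain ⟨z, hz⟩ := cubeEnl_zero_nonempty (F.P p.K) (sideχ F ν p g k) c.2
  obtain ⟨y, hy⟩ := cubeEnl_zero_nonempty (F.P p.K) (sideχ F ν p g (k + 1)) c''.2
  have hzZ := cubeχ_subset_Zreg_σOfRecord F ν M p g s t hc hz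
  have hyW := cubeχ_subset_W32_of_mem_cubes32 F ν M p g _ hc'' hy
  obtain ⟨i, hi⟩ := exists_lt_coordDist_of_mem_W32 F ν M p g hD _ hyW hzZ
  refine ⟨i, ?_⟩
  have h1 : coordDist z u i < (0 + r₁ + 1) * sideχ F ν p g k := coordDist_lt_of_mem_cubeEnl hz hu i
  have h2 : coordDist w y i < (r₂ + 0 + 1) * sideχ F ν p g (k + 1) := coordDist_lt_of_mem_cubeEnl hw hy i
  have h3 := (coordDist_triangle z u y i).trans (Nat.add_le_add_left (coordDist_triangle u w y i) _)
  rw [Nat.zero_add] at h1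
  rw [Nat.add_zero] at h2
  omega

/-- **THE NESTING IN PRINT's LETTERS**: the numeric side condition of this file follows from
`(r₁+1)·L·M₂·R_{k+1} + ρ + (r₂+1)·L²·M₂·R_{k+2} ≤ 4·L·M·R_{k+2}` — i.e. `M` exceeds `M₂` by the factor `((r₁+1)R_{k+1}∕R_{k+2} + (r₂+1)L)∕4` and a
little (print: *«M will be chosen much larger than M₂»*; `R_{k+1}∕R_{k+2} ∈ {1, L, L², …}` along monotone couplings). [cite: Balaban1988Convergent, p.245, (2.5) p.255] -/
theorem nesting_of_scales {k r₁ r₂ ρ : ℕ}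
    (h : (r₁ + 1) * ((F.P p.K).L * ν.M₂ * RkOfRecord (F.P p.K).L ν.r (g (k + 1))) + ρ +
        (r₂ + 1) * ((F.P p.K).L ^ 2 * ν.M₂ * RkOfRecord (F.P p.K).L ν.r (g (k + 2))) ≤
        4 * ((F.P p.K).L * M * RkOfRecord (F.P p.K).L ν.r (g (k + 2)))) :
    (r₁ + 1) * sideχ F ν p g k + (F.P p.K).L ^ (k + 1) * ρ + (r₂ + 1) * sideχ F ν p g (k + 1) ≤ 4 * sideD F ν M p g (k + 1) + 2 := by
  have h2 := Nat.mul_le_mul_left ((F.P p.K).L ^ (k + 1)) h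
  simp only [sideχ, sideD, cubeSide, dCubeSide, show k + 1 + 1 = k + 2 from rfl]
  calc (r₁ + 1) * ((F.P p.K).L ^ (k + 2) * ν.M₂ * RkOfRecord (F.P p.K).L ν.r (g (k + 1))) + (F.P p.K).L ^ (k + 1) * ρ +
        (r₂ + 1) * ((F.P p.K).L ^ (k + 2 + 1) * ν.M₂ * RkOfRecord (F.P p.K).L ν.r (g (k + 2)))
        = (F.P p.K).L ^ (k + 1) * ((r₁ + 1) * ((F.P p.K).L * ν.M₂ * RkOfRecord (F.P p.K).L ν.r (g (k + 1))) + ρ +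
          (r₂ + 1) * ((F.P p.K).L ^ 2 * ν.M₂ * RkOfRecord (F.P p.K).L ν.r (g (k + 2)))) := by ring
    _ ≤ (F.P p.K).L ^ (k + 1) * (4 * ((F.P p.K).L * M * RkOfRecord (F.P p.K).L ν.r (g (k + 2)))) := h2
    _ = 4 * ((F.P p.K).L ^ (k + 2) * M * RkOfRecord (F.P p.K).L ν.r (g (k + 2))) := by ring
    _ ≤ 4 * ((F.P p.K).L ^ (k + 2) * M * RkOfRecord (F.P p.K).L ν.r (g (k + 2))) + 2 := Nat.le_add_right _ _

end Gap

/-! ## §4 The plaquette separation: the box-hull of the next window's regularity regions misses the previous regularity regions -/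

section Plaquettes

variable (F : T4Family) (ν : Stage7Numerics) (M : ℕ) (p : B12.RunParams) (g : ℕ → ℝ)

/-- ★★ **THE PLAQUETTE SEPARATION.**  Along `σ s t`, let `c ∈ t.1` carry a regularity region `Rc` of level-`(k+1)` plaquettes within `r₁` χ_{k+1}-layers of `c`
and let the window cube `c″ ∈ cubes32 (k+1) (σ s t)` carry a regularity region `Rc″` of level-`(k+2)` plaquettes within `r₂` χ_{k+2}-layers of `c″` (fine positions
`embIter (j+1) p′.src`).  Under the nesting and `0 < sideD (k+1)`, `k + 1 ≤ m + K`: NO plaquette of the box `boxRegion (emb p′.src) ρ` of a `p′ ∈ Rc″` belongs to `Rc`.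
[cite: Balaban1988Convergent, p.245, p.264–265, (3.2) p.265; Balaban1987RG1, (0.1) p.251] -/
theorem not_mem_of_mem_boxRegion {k : ℕ} (hk : k + 1 ≤ (F.P p.K).m + (F.P p.K).K) (hD : 0 < sideD F ν M p g (k + 1))
    (s : SeqOfRecord F ν M g p.K k) (t : LbOfRecord F ν p g k)
    {c : Iχ F ν p g k} (hc : c ∈ t.1) {c'' : Iχ F ν p g (k + 1)} (hc'' : c'' ∈ cubes32 F ν M p g (k + 1) (σOfRecord F ν M p g k s t))
    (Rc : Finset (Plaq (F.P p.K) (k + 1))) (Rc'' : Finset (Plaq (F.P p.K) (k + 2))) {r₁ r₂ ρ : ℕ}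
    (hRc : ∀ q ∈ Rc, embIter (k + 1) q.src ∈ cubeEnl (F.P p.K) (sideχ F ν p g k) c r₁)
    (hRc'' : ∀ p' ∈ Rc'', embIter (k + 2) p'.src ∈ cubeEnl (F.P p.K) (sideχ F ν p g (k + 1)) c'' r₂)
    (hnum : (r₁ + 1) * sideχ F ν p g k + (F.P p.K).L ^ (k + 1) * ρ + (r₂ + 1) * sideχ F ν p g (k + 1) ≤ 4 * sideD F ν M p g (k + 1) + 2)
    {p' : Plaq (F.P p.K) (k + 2)} (hp' : p' ∈ Rc'') {q : Plaq (F.P p.K) (k + 1)} (hq : q ∈ boxRegion (emb p'.src) ρ) :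
    q ∉ Rc := by
  intro hqR
  obtain ⟨i, hi⟩ := exists_lt_coordDist_of_collars F ν M p g hD s t hc hc'' (hRc q hqR) (hRc'' p' hp') hnum
  have h := coordDist_embIter_le_of_mem_boxRegion hk hq i
  exact absurd (lt_of_lt_of_le hi h) (lt_irrefl _)

/-- **… AS A DISJOINTNESS**: every set `X` of level-`(k+1)` plaquettes inside the box-hull of the regularity regions `R″ c″` of window cubes `c″ ∈ D ⊆ cubes32 (k+1) (σ s t)`
is disjoint from the regularity region `Rc` of `c ∈ t.1`. [cite: Balaban1988Convergent, p.245, p.264–265, (3.2) p.265] -/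
theorem disjoint_of_subset_hull {k : ℕ} (hk : k + 1 ≤ (F.P p.K).m + (F.P p.K).K) (hD : 0 < sideD F ν M p g (k + 1))
    (s : SeqOfRecord F ν M g p.K k) (t : LbOfRecord F ν p g k)
    {c : Iχ F ν p g k} (hc : c ∈ t.1) {D : Finset (Iχ F ν p g (k + 1))} (hDW : D ⊆ cubes32 F ν M p g (k + 1) (σOfRecord F ν M p g k s t))
    (Rc : Finset (Plaq (F.P p.K) (k + 1))) (R'' : Iχ F ν p g (k + 1) → Finset (Plaq (F.P p.K) (k + 2))) {r₁ r₂ ρ : ℕ}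
    (hRc : ∀ q ∈ Rc, embIter (k + 1) q.src ∈ cubeEnl (F.P p.K) (sideχ F ν p g k) c r₁)
    (hR'' : ∀ c'' ∈ D, ∀ p' ∈ R'' c'', embIter (k + 2) p'.src ∈ cubeEnl (F.P p.K) (sideχ F ν p g (k + 1)) c'' r₂)
    (hnum : (r₁ + 1) * sideχ F ν p g k + (F.P p.K).L ^ (k + 1) * ρ + (r₂ + 1) * sideχ F ν p g (k + 1) ≤ 4 * sideD F ν M p g (k + 1) + 2)
    {X : Finset (Plaq (F.P p.K) (k + 1))} (hX : ∀ q ∈ X, ∃ c'' ∈ D, ∃ p' ∈ R'' c'', q ∈ boxRegion (emb p'.src) ρ) :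
    Disjoint X Rc := by
  rw [Finset.disjoint_left]
  intro q hqX hqR
  obtain ⟨c'', hc''D, p', hp', hq⟩ := hX q hqX
  exact not_mem_of_mem_boxRegion F ν M p g hk hD s t hc (hDW hc''D) Rc (R'' c'') hRc (hR'' c'' hc''D) hnum hp' hq hqR

end Plaquettes

/-! ## §5 At the display: module 40 §3's admissible `X` never meet module 38 §1's regularity region -/

section Display

variable (F : T4Family) (N : ℕ) [NeZero N] (ν : Stage7Numerics) (M : ℕ) (p : B12.RunParams) (g : ℕ → ℝ)

open Summit.QuantumFields.BalabanUV.T4Continuum.NE7b.PrefixExtraction (admS)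
open Summit.QuantumFields.YangMills.BalabanUVNodes.N20LCSLabelTower
open Summit.QuantumFields.YangMills.BalabanUVNodes.N20LCSWallShape (exists_le_dist1_of_eterm_ne_zero subset_labelAt_of_mem_admS)

/-- ★★★ **THE HULL OF WINDOW-ADMISSIBLE PINS MISSES THE PREVIOUS REGULARITY REGIONS** — module 40 §3's admissibility, for EVERY history.  Let the regularity
regions `R j c` (level-`(j+1)` plaquettes) sit within `r j` layers of χ_{j+1}-cubes of `c` on the fine torus (LOCALITY LETTER), `0 < M`, `k + 1 ≤ m + K`, and the
nesting hold at `k`.  Then for every history `h : Fin (k+1) → LabelPat`, every cube `c` of its LAST label's large family `P`, every pin family `D` inside the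
window `cubes32 (k+1) (seqOfHist (k+1) h)`, and every set `X` of level-`(k+1)` plaquettes with `∀ q ∈ X, ∃ c″ ∈ D, ∃ p′ ∈ R (k+1) c″, q ∈ boxRegion (emb p′.src) ρ`:
**`Disjoint X (R k c)`**. [cite: Balaban1988Convergent, p.245, (3.2)–(3.5) p.264–265, (3.20) p.269; Balaban1989LargeFieldI, (0.3)–(0.5) p.176–177] -/
theorem disjoint_hull_labelAt (hM : 0 < M) {k : ℕ} (hk : k + 1 ≤ (F.P p.K).m + (F.P p.K).K)
    (R : (j : ℕ) → Iχ F ν p g j → Finset (Plaq (F.P p.K) (j + 1))) (r : ℕ → ℕ)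
    (hR : ∀ (j : ℕ) (c : Iχ F ν p g j), ∀ p' ∈ R j c, embIter (j + 1) p'.src ∈ cubeEnl (F.P p.K) (sideχ F ν p g j) c (r j))
    {ρ : ℕ} (hnum : (r k + 1) * sideχ F ν p g k + (F.P p.K).L ^ (k + 1) * ρ + (r (k + 1) + 1) * sideχ F ν p g (k + 1) ≤
      4 * sideD F ν M p g (k + 1) + 2)
    (h : Fin (k + 1) → LabelPat F ν p g) {c : Iχ F ν p g k} (hc : c ∈ (labelAt F ν p g k (h (Fin.last k))).1)
    {D : Finset (Iχ F ν p g (k + 1))} (hD : D ⊆ cubes32 F ν M p g (k + 1) (seqOfHist F ν M p g (k + 1) h))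
    {X : Finset (Plaq (F.P p.K) (k + 1))} (hX : ∀ q ∈ X, ∃ c'' ∈ D, ∃ p' ∈ R (k + 1) c'', q ∈ boxRegion (emb p'.src) ρ) :
    Disjoint X (R k c) :=
  disjoint_of_subset_hull F ν M p g hk (sideD_pos_of_pos F ν M p g hM (k + 1)) (seqOfHist F ν M p g k (Fin.init h))
    (labelAt F ν p g k (h (Fin.last k))) hc hD (R k c) (R (k + 1)) (hR k c) (fun c'' _ => hR (k + 1) c'') hnum hX

open Classical in
/-- **… IN MODULE 38 §3's PINNED-CLASS SHAPE**: for a label-family pattern `E` pinning `D k` at level `k` (`t ∈ E k h ⇒ D k ⊆ t.1`), every history `h` of the class at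
level `k + 1`, window-admissible pins `D (k+1) ⊆ cubes32 (k+1) (seqOfHist (k+1) h)`, admissible `X`, and every `c ∈ D k`: `Disjoint X (R k c)` (module 38's
`subset_labelAt_of_mem_admS`). [cite: Balaban1988Convergent, p.245, (3.2)–(3.5) p.264–265] -/
theorem disjoint_hull_of_mem_admS (hM : 0 < M) (A₁ : ℝ) {k : ℕ} (hk : k + 1 ≤ (F.P p.K).m + (F.P p.K).K)
    (R : (j : ℕ) → Iχ F ν p g j → Finset (Plaq (F.P p.K) (j + 1))) (r : ℕ → ℕ)
    (hR : ∀ (j : ℕ) (c : Iχ F ν p g j), ∀ p' ∈ R j c, embIter (j + 1) p'.src ∈ cubeEnl (F.P p.K) (sideχ F ν p g j) c (r j))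
    {ρ : ℕ} (hnum : (r k + 1) * sideχ F ν p g k + (F.P p.K).L ^ (k + 1) * ρ + (r (k + 1) + 1) * sideχ F ν p g (k + 1) ≤
      4 * sideD F ν M p g (k + 1) + 2)
    (D : (j : ℕ) → Finset (Iχ F ν p g j)) (E : (j : ℕ) → (Fin j → LabelPat F ν p g) → Finset (LbOfRecord F ν p g j))
    (hE : ∀ h t, t ∈ E k h → D k ⊆ t.1) {h : Fin (k + 1) → LabelPat F ν p g}
    (hh : h ∈ admS (labelTowerOfRecord F N ν M p g A₁ (zeta316OfRecord F N ν M A₁)) (labelPattern F ν p g E) (k + 1))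
    (hD : D (k + 1) ⊆ cubes32 F ν M p g (k + 1) (seqOfHist F ν M p g (k + 1) h))
    {X : Finset (Plaq (F.P p.K) (k + 1))} (hX : ∀ q ∈ X, ∃ c'' ∈ D (k + 1), ∃ p' ∈ R (k + 1) c'', q ∈ boxRegion (emb p'.src) ρ)
    {c : Iχ F ν p g k} (hc : c ∈ D k) : Disjoint X (R k c) :=
  disjoint_hull_labelAt F ν M p g hM hk R r hR hnum h (subset_labelAt_of_mem_admS F N ν M p g A₁ D E hE hh hc) hD hX

/-- ★★★ **MODULE 38 §1's FORCED PLAQUETTE LIES OUTSIDE EVERY ADMISSIBLE `X` OF MODULES 40 ∕ 41.**  On the support of the level-`(k+1)` term of a history `h` whose last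
label declares `c` large, with `c` carrying the regularity letter `(R k c, ε″)`, SOME `p′ ∈ R k c` has `ε″ ≤ dist1 (V′(∂p′))` (module 38 `exists_le_dist1_of_eterm_ne_zero`)
— and that `p′` belongs to NO window-admissible hull `X`: the repaired display «LCS-(k+1) on the hull of window-admissible pins» never integrates the forced plaquette.
[cite: Balaban1988Convergent, p.245, (3.2)–(3.5) p.264–265; Balaban1985Variational, Thm 1 p.279 (the SHAPE of `hreg`); Balaban1989LargeFieldI, (0.3)–(0.5) p.176–177] -/
theorem forced_plaquette_not_mem_hull (hM : 0 < M) (A₁ : ℝ) (ρ₀ : cfgOfRecord F N p.K 0 → ℝ) {k : ℕ} (hk : k + 1 ≤ (F.P p.K).m + (F.P p.K).K)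
    (R : (j : ℕ) → Iχ F ν p g j → Finset (Plaq (F.P p.K) (j + 1))) (r : ℕ → ℕ)
    (hR : ∀ (j : ℕ) (c : Iχ F ν p g j), ∀ p' ∈ R j c, embIter (j + 1) p'.src ∈ cubeEnl (F.P p.K) (sideχ F ν p g j) c (r j))
    {ρ : ℕ} (hnum : (r k + 1) * sideχ F ν p g k + (F.P p.K).L ^ (k + 1) * ρ + (r (k + 1) + 1) * sideχ F ν p g (k + 1) ≤
      4 * sideD F ν M p g (k + 1) + 2)
    (h : Fin (k + 1) → LabelPat F ν p g) {c : Iχ F ν p g k} (hc : c ∈ (labelAt F ν p g k (h (Fin.last k))).1) {ε'' : ℝ}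
    (hreg : ∀ V' : GaugeField (F.P p.K) (k + 1) (SU N),
      (∀ p' ∈ R k c, dist1 (GaugeField.plaqHol V' p') < ε'') → chiFactor F N ν p g k c V' = 1)
    (V' : cfgOfRecord F N p.K (k + 1))
    (hne : (labelTowerOfRecord F N ν M p g A₁ (zeta316OfRecord F N ν M A₁)).eterm ρ₀ (k + 1) h V' ≠ 0)
    {D : Finset (Iχ F ν p g (k + 1))} (hD : D ⊆ cubes32 F ν M p g (k + 1) (seqOfHist F ν M p g (k + 1) h))
    {X : Finset (Plaq (F.P p.K) (k + 1))} (hX : ∀ q ∈ X, ∃ c'' ∈ D, ∃ p' ∈ R (k + 1) c'', q ∈ boxRegion (emb p'.src) ρ) :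
    ∃ p' ∈ R k c, ε'' ≤ dist1 (GaugeField.plaqHol V' p') ∧ p' ∉ X := by
  obtain ⟨p', hp', hle⟩ := exists_le_dist1_of_eterm_ne_zero F N ν M p g A₁ ρ₀ k h hc (R k c) hreg V' hne
  exact ⟨p', hp', hle, fun hpX =>
    Finset.disjoint_left.1 (disjoint_hull_labelAt F ν M p g hM hk R r hR hnum h hc hD hX) hpX hp'⟩

end Display

end Summit.QuantumFields.YangMills.BalabanUVNodes.N20LCSHullSeparation

end
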